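import Summits.CriticalPhenomena.SAWScalingLimit.Theses.SAWCircleScreening
import Summits.CriticalPhenomena.SAWScalingLimit.Theorems.SubseqIdentification.Negative.CoincidentEndpointLaw
import Literature.Probability.RandomPlanarGeometry.TranslatedRectangleDomains
import Literature.Probability.LatticeModels.MeshDomainBulk
import HarnessLib

/-!
# Route `SAWCircleScreening`, item `EndpointCouplingTame` (stmt-CriticalPhenomena-5467):
non-vacuity of the tame class

The item quantifies over Dobrushin domains that are EXACTLY flat (open half-discs) in a ball
around each marked point, and over pairs of endpoint approximations. This file exhibits an
honest instance of all hypotheses at once (`exists_tame_dobrushinDomain_isEndpointApprox`): the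
square `(-1, 1)²` (`rectDomain 1 1`, boundary the closed polygon through its corners) marked at
the midpoints `(1, 0)` and `(-1, 0)` of its right and left sides (boundary parameters `3/8`,
`7/8`; `rectDomain_boundary_right`, `rectDomain_boundary_left`) is flat in the unit ball around
each marked point (normals `-i`, `i`), and the lattice points `(±(⌈δ⁻¹⌉ - 1), 0)` form an
endpoint approximation (`tendsto_meshPoint_stdA/B` of
`SubseqIdentification.Negative.CoincidentEndpointLaw`; they are joined in `Ω_δ` because the
square's mesh vertex graph is connected by lattice staircases,
`meshVertexGraph_reachable_of_rectangle_subset`, so `Ω_δ` is all of `δℤ² ∩ (-1, 1)²`,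
`mem_meshDomain_symRect`). A canonical tame test domain for the cruxes S1–S3 as well.

No new definitions (the Dobrushin square is built inside the proof).

## References

* G. F. Lawler, O. Schramm, W. Werner, *On the scaling limit of planar self-avoiding walk*,
  Proc. Sympos. Pure Math. 72 (2004), §3.4.2 (nearest-point endpoint convention)
  [LawlerSchrammWerner2004SAW].
-/

noncomputable section

open MeasureTheory Filter Topology Set Complex
open scoped NNReal ENNReal
open Literature.Probability.RandomPlanarGeometry Literature.Probability.RandomPlanarGeometry.SAW
open Literature.Probability.LatticeModels

namespace Summit.CriticalPhenomena.SAWScalingLimit.Theorems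

open Summit.CriticalPhenomena.SAWScalingLimit.Theses.SAWCircleScreening

/-! ### The square `(-1, 1)²`: boundary midpoints and discrete domain -/

/-- The right side of `rectDomain a b`: parameters `(1 + θ) / 4`, `θ ∈ [0, 1]`, run from `(a, -b)`
to `(a, b)`. [folklore] -/
theorem rectDomain_boundary_right {a b : ℝ} (ha : 0 < a) (hb : 0 < b) {θ : ℝ}
    (hθ : θ ∈ Icc (0 : ℝ) 1) :
    (rectDomain a b ha hb).boundary ((1 + θ) / 4) = ⟨a, -b + 2 * b * θ⟩ := by
  have h := polygonLoop_apply_div (l := rectVerts a b) (k := 1) (by simp) hθ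
  simp only [Nat.cast_one, length_rectVerts, Nat.cast_ofNat, Nat.reduceAdd, Nat.reduceMod] at h
  change polygonLoop (rectVerts a b) ((1 + θ) / 4) = _
  rw [h]
  simp only [rectVerts, List.getElem_cons_zero, List.getElem_cons_succ,
    AffineMap.lineMap_apply_module']
  apply Complex.ext
  · simp
  · simp; ring

/-- The left side of `rectDomain a b`: parameters `(3 + θ) / 4`, `θ ∈ [0, 1]`, run from `(-a, b)`
to `(-a, -b)`. [folklore] -/
theorem rectDomain_boundary_left {a b : ℝ} (ha : 0 < a) (hb : 0 < b) {θ : ℝ}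
    (hθ : θ ∈ Icc (0 : ℝ) 1) :
    (rectDomain a b ha hb).boundary ((3 + θ) / 4) = ⟨-a, b - 2 * b * θ⟩ := by
  have h := polygonLoop_apply_div (l := rectVerts a b) (k := 3) (by simp) hθ
  simp only [Nat.cast_ofNat, length_rectVerts, Nat.reduceAdd, Nat.reduceMod] at h
  change polygonLoop (rectVerts a b) ((3 + θ) / 4) = _
  rw [h]
  simp only [rectVerts, List.getElem_cons_zero, List.getElem_cons_succ,
    AffineMap.lineMap_apply_module']
  apply Complex.ext
  · simp
  · simp; ring

/-- In the open square `(-1, 1)²` the closed rectangle spanned by two points of the square stays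
in the square (a product of intervals), so any two mesh vertices are joined in the mesh vertex
graph (staircase lemma `meshVertexGraph_reachable_of_rectangle_subset`). [folklore] -/
theorem meshVertexGraph_symRect_preconnected {δ : ℝ} (hδ : 0 < δ) :
    (meshVertexGraph (symRect 1 1) δ).Preconnected := by
  rintro ⟨x, hx⟩ ⟨y, hy⟩
  refine meshVertexGraph_reachable_of_rectangle_subset hδ _ x y rfl ?_ hx hy
  intro z hz
  rw [mem_meshVertices_iff, mem_symRect] at hx hy
  rw [mem_symRect]
  simp only [Rectangle, Complex.mem_reProdIm, mem_uIcc] at hz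
  obtain ⟨hre, him⟩ := hz
  constructor
  · rcases hre with ⟨h1, h2⟩ | ⟨h1, h2⟩ <;> constructor <;>
      linarith [hx.1.1, hx.1.2, hy.1.1, hy.1.2]
  · rcases him with ⟨h1, h2⟩ | ⟨h1, h2⟩ <;> constructor <;>
      linarith [hx.2.1, hx.2.2, hy.2.1, hy.2.2]

/-- For the square, `Ω_δ` is all of `δℤ² ∩ (-1, 1)²` (one mesh component). [folklore] -/
theorem mem_meshDomain_symRect {δ : ℝ} (hδ : 0 < δ) {x : Site 2}
    (hx : x ∈ meshVertices (symRect 1 1) δ) : x ∈ meshDomain (symRect 1 1) δ := by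
  have hsub := (meshVertexGraph_symRect_preconnected hδ).subsingleton_connectedComponent
  simp only [meshDomain, Set.mem_iUnion, Set.mem_image]
  refine ⟨(meshVertexGraph (symRect 1 1) δ).connectedComponentMk ⟨x, hx⟩, fun C' => ?_,
    ⟨x, hx⟩, ?_, rfl⟩
  · rw [Subsingleton.elim C' ((meshVertexGraph (symRect 1 1) δ).connectedComponentMk ⟨x, hx⟩)]
  · rw [SimpleGraph.ConnectedComponent.mem_supp_iff]

/-- Any two lattice points of the square are joined in its discrete domain `Ω_δ`. [folklore] -/
theorem reachable_symRect {δ : ℝ} (hδ : 0 < δ) {x y : Site 2}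
    (hx : meshPoint δ x ∈ symRect 1 1) (hy : meshPoint δ y ∈ symRect 1 1) :
    (discreteDomainGraph (symRect 1 1) δ).Reachable x y := by
  let hom : meshVertexGraph (symRect 1 1) δ →g discreteDomainGraph (symRect 1 1) δ :=
    { toFun := Subtype.val
      map_rel' := fun {u v} h =>
        discreteDomainGraph_adj_iff.2 ⟨h, mem_meshDomain_symRect hδ u.2,
          mem_meshDomain_symRect hδ v.2⟩ }
  exact (meshVertexGraph_symRect_preconnected hδ ⟨x, hx⟩ ⟨y, hy⟩).map hom

/-! ### Non-vacuity of the tame class -/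

open SubseqIdentification.Negative in
/-- **The tame class of `EndpointCouplingTame` is inhabited, honestly.** The square `(-1, 1)²`
with marked points the midpoints `(1, 0)`, `(-1, 0)` of its right and left sides is a Dobrushin
domain exactly flat in the ball of radius `1` around each marked point (open half-discs, normals
`u₀ = -i`, `u₁ = i`), and it carries an endpoint approximation: the lattice points
`(⌈δ⁻¹⌉ - 1, 0) → (1, 0)` and `(-(⌈δ⁻¹⌉ - 1), 0) → (-1, 0)`, joined in `Ω_δ` (the square's mesh
graph is connected, `reachable_symRect`). So the hypotheses of the item are satisfiable
simultaneously and its `∀` is not vacuous. [folklore] -/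
theorem exists_tame_dobrushinDomain_isEndpointApprox :
    ∃ (D : DobrushinDomain) (a b : ℝ → Site 2),
      (∃ (ρ₀ : ℝ) (u₀ u₁ : ℂ), 0 < ρ₀ ∧
        D.carrier ∩ Metric.ball (D.pt 0) ρ₀ =
          {z | u₀ = 0 ∨ 0 < ((z - D.pt 0) * u₀).im} ∩ Metric.ball (D.pt 0) ρ₀ ∧
        D.carrier ∩ Metric.ball (D.pt 1) ρ₀ =
          {z | u₁ = 0 ∨ 0 < ((z - D.pt 1) * u₁).im} ∩ Metric.ball (D.pt 1) ρ₀) ∧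
      IsEndpointApprox D a b := by
  -- the square with marks at parameters `3/8` (right midpoint) and `7/8` (left midpoint)
  let D : DobrushinDomain :=
    { toJordanDomain := rectDomain 1 1 one_pos one_pos
      mark := ![3 / 8, 7 / 8]
      strictMono_mark := by
        refine Fin.strictMono_iff_lt_succ.2 fun k => ?_
        fin_cases k
        norm_num
      mark_mem := fun k => by fin_cases k <;> norm_num }
  have hpt0 : D.pt 0 = 1 := by
    change (rectDomain 1 1 one_pos one_pos).boundary (3 / 8) = 1
    have h := rectDomain_boundary_right one_pos one_pos (θ := 1 / 2) ⟨by norm_num, by norm_num⟩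
    rw [show ((1 : ℝ) + 1 / 2) / 4 = 3 / 8 by norm_num] at h
    rw [h]
    apply Complex.ext <;> norm_num
  have hpt1 : D.pt 1 = -1 := by
    change (rectDomain 1 1 one_pos one_pos).boundary (7 / 8) = -1
    have h := rectDomain_boundary_left one_pos one_pos (θ := 1 / 2) ⟨by norm_num, by norm_num⟩
    rw [show ((3 : ℝ) + 1 / 2) / 4 = 7 / 8 by norm_num] at h
    rw [h]
    apply Complex.ext <;> norm_num
  have hcar : D.carrier = symRect 1 1 := rfl
  refine ⟨D, fun δ => ![⌈δ⁻¹⌉ - 1, 0], fun δ => ![-(⌈δ⁻¹⌉ - 1), 0],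
    ⟨1, -Complex.I, Complex.I, one_pos, ?_, ?_⟩, ?_⟩
  · -- flat near `pt 0 = 1`: inside `B(1, 1)` the square is `{re z < 1}`
    rw [hpt0, hcar]
    ext z
    simp only [mem_inter_iff, mem_symRect, Metric.mem_ball, mem_setOf_eq, Complex.I_ne_zero,
      neg_eq_zero, false_or]
    have him : ((z - 1) * -Complex.I).im = 1 - z.re := by simp
    rw [him]
    constructor
    · rintro ⟨⟨h, -⟩, hd⟩
      exact ⟨by linarith [h.2], hd⟩
    · rintro ⟨h, hd⟩
      have h1 : |(z - 1).re| < 1 := (Complex.abs_re_le_norm _).trans_lt (by rwa [← dist_eq_norm])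
      have h2 : |(z - 1).im| < 1 := (Complex.abs_im_le_norm _).trans_lt (by rwa [← dist_eq_norm])
      rw [Complex.sub_re, Complex.one_re, abs_lt] at h1
      rw [Complex.sub_im, Complex.one_im, sub_zero, abs_lt] at h2
      exact ⟨⟨⟨by linarith, by linarith⟩, h2.1, h2.2⟩, hd⟩
  · -- flat near `pt 1 = -1`: inside `B(-1, 1)` the square is the half-plane `-1 < re z`
    rw [hpt1, hcar]
    ext z
    simp only [mem_inter_iff, mem_symRect, Metric.mem_ball, mem_setOf_eq, Complex.I_ne_zero,
      false_or]
    have him : ((z - -1) * Complex.I).im = z.re + 1 := by simp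
    rw [him]
    constructor
    · rintro ⟨⟨h, -⟩, hd⟩
      exact ⟨by linarith [h.1], hd⟩
    · rintro ⟨h, hd⟩
      have h1 : |(z - -1).re| < 1 := (Complex.abs_re_le_norm _).trans_lt (by rwa [← dist_eq_norm])
      have h2 : |(z - -1).im| < 1 := (Complex.abs_im_le_norm _).trans_lt (by rwa [← dist_eq_norm])
      rw [Complex.sub_re, Complex.neg_re, Complex.one_re, abs_lt] at h1
      rw [Complex.sub_im, Complex.neg_im, Complex.one_im, neg_zero, sub_zero, abs_lt] at h2
      exact ⟨⟨⟨by linarith, by linarith⟩, h2.1, h2.2⟩, hd⟩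
  · -- the honest endpoint approximation along the real axis
    refine ⟨?_, ?_, ?_⟩
    · filter_upwards [Ioo_mem_nhdsGT (show (0 : ℝ) < 2 by norm_num)] with δ hδ
      rw [hcar]
      have hA := stdA_mem hδ.1 hδ.2
      have hB := stdB_mem hδ.1 hδ.2
      -- points of the unit disc on the real axis lie in the square
      have hsq : ∀ {w : ℂ}, w ∈ Metric.ball (0 : ℂ) 1 → w.im = 0 → w ∈ symRect 1 1 := by
        intro w hw hw0
        rw [Metric.mem_ball, dist_zero_right] at hw
        have h1 := (Complex.abs_re_le_norm w).trans_lt hw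
        rw [abs_lt] at h1
        rw [mem_symRect, hw0]
        exact ⟨h1, by norm_num, by norm_num⟩
      exact reachable_symRect hδ.1 (hsq hA (by simp)) (hsq hB (by simp))
    · rw [hpt0]; exact tendsto_meshPoint_stdA
    · rw [hpt1]; exact tendsto_meshPoint_stdB

end Summit.CriticalPhenomena.SAWScalingLimit.Theorems
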